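/- Copyright: the b2b-balaban cell (near-miss cell 7), T⁴-continuum fan-out, row NE7b CRUX team (2), seat
`t4-ne7b-formalise-leaf-06` (gen 144) — third-named typist's build of the OWNER's INTERFACE REQUEST NE7b IR-103-2 (b) «THE END AT THE TOWER,
COUNT DERIVED» (OWNER `t4-ne7b-p1` g103, rulings W-ne7bp1-g103-4 C-4 ∕ W-ne7bp1-g103-5 (2); memo `t4/b2b-balaban-t4-ne7b-p1/g103/F-RHO-TOWER-g103.md`
§7 REFINED (b) + CORRECTION), part 2 of 2: the pinned `_rel` END and the road.  Released under the licence of the surrounding project. -/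
import Summits.QuantumFields.BalabanUV.T4Continuum.Support.B16HistoryTowerExtractionPricedDataLWR
import Summits.QuantumFields.BalabanUV.T4Continuum.Spine.NE7b.RealisedPinnedRelPDWTL

/-!
# (α)-INSTANCE — THE END AT THE TOWER, COUNT DERIVED, part 2: the road `hybridNE7Under_of_towerExtractionPriced_fsc` over the PINNED
`_rel` END (`Spine/NE7b/RealisedPinnedRelPDWTL`) and the terminal theorem `continuumYM4Torus_of_towerExtractionPriced_fsc`

Summits-side support leaf of the T⁴-continuum cell (rung (B)+1 on a FINITE torus only; NOT infinite volume, NOT the mass gap, NOT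
Clay; NOT a proof of NE7b — the cell's OWN estimate `T4WeightBudget.RelWeightBound`, NOT PRINTED, NOT PROVED).  [folklore] COMPOSITION BY
NAME of landed declarations (theorems only; no `def`, no `structure`, no `[cite:]` tag, no `Prop` minted, zero `sorry`).  INTERFACE REQUEST
NE7b IR-103-2 (b) (OWNER `t4-ne7b-p1` g103; typist leaf-06 g144, INTENT I-leaf06-g144-1, journal l.51194), second half; part 1
(`B16HistoryTowerExtractionPricedDataLWR`, record `TowerExtractionPricedDataLWR`) carries the hypotheses' shape; the socket — the PINNED `_rel`
END `NE7b.RealisedPinnedRelPDWTL.hybridNE7_of_realisedDomainsRunW_pinnedT3bPDTL_rel` (thresholds from `BetaPertHyp`, NO (B) side) — is its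
own `Spine/NE7b/` file (the 400-line rule; lane ∕ name at the OWNER's word).

WHY.  Memo §7 REFINED (b) ∕ ruling W-ne7bp1-g103-5 (2): the «count DERIVED» chain of record for the tower is L0 `Spine/NE7b/TreeBindersRel`
(p354247) → L1 `TermReadingRel` (p354853) → leaf-01 g77's P∕W∕T twins `RealisedRunRelPWT` (p356585) → `RealisedDomainsRelPWT` →
`RealisedEndRelPWT` → `RealisedEndRelPDWTL` → THIS FILE: the END at the tower through `RealisedEndRelPDWTL.hybridNE7_of_realisedDomainsRunW_printedT3bPDTL_rel`
(in place of 2R's `HistoryRealiseCellsRunMultEndPDWTL.…T3bPDTL`) → `HistoryRealiseCellsRunApexT3b.stringHybridNE7_of_hybridNE7_repr` → headline.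
IR-103-1's road (`B16HistoryTowerExtractionEnd`) reaches `HybridNE7` from the DISPLAYED count through `PinnedExtraction.exists_relWeightBound_of_extraction_majorant`
and the seam `CountSeamJunction.hybridNE7_of_eventually`; THIS road reaches it from the PRICE SENTENCES through the cell's multiplicity-socket
levels re-cut at the relative display — the count is DERIVED (inside `TreeBindersRel` ∕ `TermReadingRel` ∕ the PWT twins), not displayed.

WHAT.
§0 (imported) `NE7b.RealisedPinnedRelPDWTL.hybridNE7_of_realisedDomainsRunW_pinnedT3bPDTL_rel` — THE PINNED `_rel` END: leaf-02's L2
re-run over leaf-01's `RealisedEndRelPDWTL.…T3bPDTL_rel`; flow side from `BetaPertHyp`, the infrared clause and THE LEVEL on `]0, g₁]`; NO `hB`,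
NO `hsign`, NO `Em`.
§1 Over ONE record `Sd : TowerExtractionPricedDataLWR …`: `fibM'_of_extractB` (run B's display moved from run B's terms to run A's index over
`weightB μ RA Sd.trunc` — IR-103-1 part 2's three rewrites `weightB`, `sum_fibre_aggW_eq`, `sum_aggW_eq (Sd.htr K hK)`); the READING's side of the
END exactly as L5's `HistoryRealiseCellsRunAssemblyWTVSL.nonempty_countRoadWitnessT3bWTVSL_of_histReadingL` supplies it at the tower reading
`Sd.𝒮.reading Sd.T Sd.p₀` (2R's `toLP82R`: `hN := 𝒮.newOK_run … hν`, `hRm ∕ hRmS ∕ hRm2`, `hD`, `hreg`): `realised_of_towerExtractionPriced`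
(`InputFamily.realisedDomainsRW_of_familyV` with the box input `RunInputM.inBoxOK_of_regionsInBox … hreg`, transported along `hL ∕ hs`),
`boxedBirths_of_towerExtractionPriced` (`InputFamily.boxedBirths_pedV … hreg`), the guarded join display by `InputFamily.disjointJoinsL_pedV`; the
E1∕E2 identities `reprA_of_towerExtractionPriced ∕ reprB_of_towerExtractionPriced` (IR-103-1 part 2's, verbatim: `H2A` + `holdsFam` + `intA`,
`reprB_of_holds_trunc` + `htr`).  §2 **`hybridNE7Under_of_towerExtractionPriced_fsc`**: §0's thresholds `min`-ed with the record family's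
(`ForSmallCouplings`), the `_rel` END fed FROM THE RECORD (`R := Sd.𝒮.R`, the pass-V carriers `pedV ∕ id ∕ liveCV ∕ ZV`, `κ = κ′ := costT` with
`hκ = hκ′ := le_rfl`, `hA0 ∕ hA0′ := Repr172R.weight_nonneg ∕ weightB_nonneg` at the letter `1`, `hqA hqB fibM fibM′ hPq hPq′ := Sd.qA_nonneg
Sd.qB_nonneg Sd.extractA (fibM'_of_extractB Sd) Sd.priceA Sd.priceB`, `hSh hTB := Sd.shell Sd.budget`, the four rates), the string step by
`stringHybridNE7_of_hybridNE7_repr` — conclusion `T4ApexHybrid.HybridNE7Under D (BetaPertHyp D.βfun)` (L3b's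
`hybridNE7Under_of_countRoadT3bPWTVSL_fsc` pattern).  HONEST NOTE: unlike IR-103-1's pin-free road this road READS `hβ` (the END's flow rows),
so the apex input is proved at `Hβ := BetaPertHyp D.βfun`; NO `EndpointExistence` twin is stated.
§3 `targets_of_towerExtractionPriced_fsc` ∕ **`continuumYM4Torus_of_towerExtractionPriced_fsc`** for (0.4)-block-averaged data on `SU(N)`:
`T4ApexHybrid.targets_of_hybridNE7Under` ∘ §2, then `T4ContinuumYM4Torus.continuumYM4Torus_of_targets hB hβ`.  Binder list = 2R's
`B16HistoryTowerEndLWRP82.continuumYM4Torus_of_towerReadingLWR_fsc` MINUS `hsign` with the UNSPLIT slack `C.a + θ ≤ ½γ₀A₁²` (no M5-2c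
volume remainder on the `_rel` road) and the record `TowerExtractionPricedDataLWR` (four carriers; its window letter `b₀` kept APART from the
threshold's `β₀`, as in 2R) — «the constants re-enter the terminal theorem, as in 2R» (memo §7 (b)).  `hsign : B16.SignConventions D.C` is
DROPPED (ruling W-ne7bp1-g104-2 C-4 «keep it only if a consumer below the seam still reads it — say which»): its one consumer on the 2R road
was the (B)-side witness `hcor` of the non-`_rel` END (`HistoryRealiseCellsRunMultEndPDWTL.…T3bPDTL`, fed by L2 from `hB.2`); below the END this
road calls only `HistoryRealiseCellsRunApexT3b.stringHybridNE7_of_hybridNE7_repr`, `T4ApexHybrid.targets_of_hybridNE7Under` and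
`T4ContinuumYM4Torus.continuumYM4Torus_of_targets`, none of which takes the sign conventions.

WHAT REMAINS DISPLAYED (census; DISPLAYED, NOT DISCHARGED).  CONSTANTS (binders of §3): `ThresholdOK`, `0 < C.μ`, the κ₁∕E₀ largeness,
`1 ≤ A₀`, `0 < β₀`, `L·β₀ ≤ 1`, `13 ≤ n₁`, `0 < θ` with `C.a + θ ≤ ½γ₀A₁²`, `0 < E₂`, `0 ≤ E₃`, row S6g′'s `sS ∕ θc` arithmetic — all
INHABITED by O(1) constants (`HistoryRealiseCellsRunHeadlineT3bPWTVS.exists_consts_countRoadT3bPWTVS`, not re-proved here).  PINS: `(B)` and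
`BetaPertHyp` BY NAME (the former consumed by `continuumYM4Torus_of_targets` only, the latter ALSO by §0's flow side).  THE RECORD, per
small-coupling tuned run and loop string: H3 = the step reading `𝒮` with its flow ∕ memory rows and the pass-V input conditions `hD ∕ hreg`,
**`extractA ∕ extractB`** (H3^NE7b at the partial sums, print's KIND — [Balaban1989LargeFieldII] (1.79)–(1.89) with the pinned genealogy's
operations bounded, RELATIVE; NOT in print) and **`priceA ∕ priceB`** («the relative weight of a pinned live key family is at most its PRINTED
PRICE»); print's per-step sentences and letter tables (displayed only); NE7c's `shell`; NE7's `budget`; four summable rates.  BY-NAME EFFECT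
ON THE WALL: the (α) road's terminal theorem no longer displays the cell's count (`countA ∕ countB` of IR-103-1) — a relocation INSIDE the
cell's own bookkeeping, NOT a discharge of anything Bałaban's; (A1c) still OWES `extractA ∕ extractB` + `priceA ∕ priceB` + the identification.
NE7b NOT PRINTED ∕ NOT PROVED; spine PROVED 0∕9; rung (B)+1 on a FINITE torus — NOT infinite volume, NOT the mass gap, NOT Clay.
HONEST DEPENDENCY (cell): continuum YM on T⁴ ⇐ BetaPertH ∧ nine spine estimates (0/9 proved); BetaPertH ⇐ (D1) ∧ (D4) ∧ CAP+tail;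
G-an2-4 gates asym, D1 and NE2/3/4.  This file changes none of it.
-/

open Finset MeasureTheory
open Literature.MathematicalPhysics.QuantumFieldTheory.Balaban1983to89
open T4PersistenceDictionary T4PersistentHistoryCount T4BankedInduction T4PrintedShapeBanking
open T4WeightBudget T4GlobalDenominator T4LiveClassFibration T4LiveStructureGas T4LiveGasToTerms T4RecordPriceSeam
open T4PartnerMultiplicity T4IndicatorShell T4MatchingAssembly T4MatchingClosure T4MatchingClosureSocket T4Continuum
open T4StabilitySocket T4BranchingRecordsGas T4TaggedShapeBanking T4CanonicalMenus T4RenewalChains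
open Summit.QuantumFields.BalabanUV.T4Continuum.PlacementBatch
open Summit.QuantumFields.BalabanUV.T4Continuum.PlacementSkeleton
open Summit.QuantumFields.BalabanUV.T4Continuum.CountThresholdUniform
open Summit.QuantumFields.BalabanUV.T4Continuum.CountThresholdExit
open Summit.QuantumFields.BalabanUV.T4Continuum.CountSeamJunction
open Summit.QuantumFields.BalabanUV.T4Continuum.LateMergers
open Summit.QuantumFields.BalabanUV.T4Continuum.HistoryFlow
open Summit.QuantumFields.BalabanUV.T4Continuum.HistoryRegeneration
open Summit.QuantumFields.BalabanUV.T4Continuum.HistoryTables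
open Summit.QuantumFields.BalabanUV.T4Continuum.HistoryAssemblyTrees
open Summit.QuantumFields.BalabanUV.T4Continuum.HistoryAssemblyTerms
open Summit.QuantumFields.BalabanUV.T4Continuum.HistoryAssemblyPedigree
open Summit.QuantumFields.BalabanUV.T4Continuum.HistoryConstants
open Summit.QuantumFields.BalabanUV.T4Continuum.HistoryGen
open Literature.MathematicalPhysics.QuantumFieldTheory.Balaban1983to89.B13ScaleTransfer
open Summit.QuantumFields.BalabanUV.T4Continuum.ZoneSkeleton
open Summit.QuantumFields.BalabanUV.T4Continuum.HistorySocketTH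
open Summit.QuantumFields.BalabanUV.T4Continuum.HistoryCaps
open Summit.QuantumFields.BalabanUV.T4Continuum.HistoryAssemblyPrice
open Summit.QuantumFields.BalabanUV.T4Continuum.HistoryBankingLE
open Summit.QuantumFields.BalabanUV.T4Continuum.HistoryExitLE
open Summit.QuantumFields.BalabanUV.T4Continuum.HistoryAssemblyTreesLE
open Summit.QuantumFields.BalabanUV.T4Continuum.HistoryAssemblyTermsLE
open Summit.QuantumFields.BalabanUV.T4Continuum.HistoryRealise
open Summit.QuantumFields.BalabanUV.T4Continuum.HistoryAssemblyRealiseLE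
open Summit.QuantumFields.BalabanUV.T4Continuum.HistoryAssemblyMult
open Summit.QuantumFields.BalabanUV.T4Continuum.HistoryAssemblyMultKey
open Summit.QuantumFields.BalabanUV.T4Continuum.HistoryAssemblyRealiseRun
open Summit.QuantumFields.BalabanUV.T4Continuum.HistoryAssemblyRealiseMult
open Summit.QuantumFields.BalabanUV.T4Continuum.HistoryZones
open Summit.QuantumFields.BalabanUV.T4Continuum.HistoryRealiseCells
open Summit.QuantumFields.BalabanUV.T4Continuum.HistoryRealiseCellsRun
open Summit.QuantumFields.BalabanUV.T4Continuum.HistoryAssemblyRealiseRunMult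
open Summit.QuantumFields.BalabanUV.T4Continuum.HistoryRealiseCellsRunMult
open Summit.QuantumFields.BalabanUV.T4Continuum.HistoryAssemblyMultInstance
open Summit.QuantumFields.BalabanUV.T4Continuum.HistoryJoinsPlacedMember
open Summit.QuantumFields.BalabanUV.T4Continuum.PlacementSkeleton
open Summit.QuantumFields.BalabanUV.T4Continuum.HistoryJoinsPlacedMult
open Summit.QuantumFields.BalabanUV.T4Continuum.HistoryRealiseDistinct
open Summit.QuantumFields.BalabanUV.T4Continuum.HistoryRegionTemplates
open Summit.QuantumFields.BalabanUV.T4Continuum.HistoryCaps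
open Summit.QuantumFields.BalabanUV.T4Continuum.HistoryZoneEvolve (cth)
open Literature.MathematicalPhysics.QuantumFieldTheory.Balaban1983to89.B16SProfile (DropCtl)
open Summit.QuantumFields.BalabanUV.T4Continuum.HistoryRealiseCellsRunMultEnd
open Summit.QuantumFields.BalabanUV.T4Continuum.HistoryRealiseCellsRunMultP
open Summit.QuantumFields.BalabanUV.T4Continuum.HistoryRealiseCellsRunMultEndP
open Summit.QuantumFields.BalabanUV.T4Continuum.HistoryRealisePrint
open Summit.QuantumFields.BalabanUV.T4Continuum.HistoryRealiseWeak
open Summit.QuantumFields.BalabanUV.T4Continuum.HistoryRealiseWeakReading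
open Summit.QuantumFields.BalabanUV.T4Continuum.HistoryRealiseWeakCells
open Summit.QuantumFields.BalabanUV.T4Continuum.HistoryAssemblyRealiseRunMultW
open Summit.QuantumFields.BalabanUV.T4Continuum.HistoryAssemblyRealiseRunMultPWT
open Summit.QuantumFields.BalabanUV.T4Continuum.HistoryAssemblyMultInstanceW
open Summit.QuantumFields.BalabanUV.T4Continuum.HistoryRealiseCellsRunMultW
open Summit.QuantumFields.BalabanUV.T4Continuum.HistoryRealiseCellsRunMultPWT
open Summit.QuantumFields.BalabanUV.T4Continuum.HistoryRealiseCellsRunMultEndW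
open Summit.QuantumFields.BalabanUV.T4Continuum.HistoryRealiseCellsRunMultEndDW
open Summit.QuantumFields.BalabanUV.T4Continuum.HistoryRealiseCellsRunMultEndPWT
open Summit.QuantumFields.BalabanUV.T4Continuum.HistoryRealiseCellsRunMultEndPD
open Summit.QuantumFields.BalabanUV.T4Continuum.HistoryRealiseDistinctGuarded
open Summit.QuantumFields.BalabanUV.T4Continuum.HistoryAssemblyMultInstanceWL
open Summit.QuantumFields.BalabanUV.T4Continuum.NE7b.RealisedEndRelPWT
open Summit.QuantumFields.BalabanUV.T4Continuum.HistoryRealiseCellsRunMultEndPDWTL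
open Summit.QuantumFields.BalabanUV.T4Continuum.HistoryRealiseCellsRunApexT3b Summit.QuantumFields.BalabanUV.T4Continuum.HistoryGenealogyRealise
open Summit.QuantumFields.BalabanUV.T4Continuum.HistoryGenealogyInstantiate Summit.QuantumFields.BalabanUV.T4Continuum.B16HistoryIndexedRepr
open Summit.QuantumFields.BalabanUV.T4Continuum.B16HistoryIndexedTrunc Summit.QuantumFields.BalabanUV.T4Continuum.HistoryRealiseCellsRunAssemblyWTVSData
open Summit.QuantumFields.BalabanUV.T4Continuum.B16HistoryReprChain Summit.QuantumFields.BalabanUV.T4Continuum.B16HistoryReprInstance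
open Summit.QuantumFields.BalabanUV.T4Continuum.B16HistoryReprRead Summit.QuantumFields.BalabanUV.T4Continuum.B16HistoryReprReadCausal
open Summit.QuantumFields.BalabanUV.T4Continuum.NE7b.RealisedEndRelPDWTL
open Summit.QuantumFields.BalabanUV.T4Continuum.NE7b.RealisedPinnedRelPDWTL
open Summit.QuantumFields.BalabanUV.T4Continuum.B16HistoryTowerExtractionPricedDataLWR

namespace Summit.QuantumFields.BalabanUV.T4Continuum.B16HistoryTowerExtractionEnd2

noncomputable section

set_option synthInstance.maxSize 1024


/-! ## §1 Over one record: run B's display at run A's index, the E1∕E2 identities, the READING's side of the END -/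

section Road

variable {F : T4Family} {G : Type*} [GaugeGroup G] [MeasurableSpace G] [HaarData G]
  {D : FiniteEpsData F G} {C : T4PrintedShapeBanking.Consts} {O : PrintedO1s} {θv : ℝ} {rr d n : ℕ} {hn : 0 < n}
  {g₀ : ℕ → ℝ} {os : List (ULoop F)} {cΛ M Φ b₀ : ℝ} {p₁ η η' κ κ₂ κᵥ : ℕ}
  {P : Type} [DecidableEq P] {X : ℕ → ℕ → Type} {𝒢 : (K j : ℕ) → GoodClass (X K j)}
  [∀ K, MeasurableSpace (X K K)] {μ : (K : ℕ) → Measure (X K K)} [∀ K, IsFiniteMeasure (μ K)]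

/-- **RUN B's EXTRACTION DISPLAY AT RUN A's INDEX** (= the `_rel` END's `fibM′` at the tower): the record's `extractB` (run B's own terms
through `trunc`, the ruling's form) moved to node O's partial summation `weightB μ RA Sd.trunc` by IR-103-1 part 2's three rewrites
(`weightB`, `B16HistoryIndexedTrunc.sum_fibre_aggW_eq` on the fibre side, `sum_aggW_eq (Sd.htr K hK)` on the full sum). [folklore] -/
theorem fibM'_of_extractB (Sd : TowerExtractionPricedDataLWR D C O θv rr d n hn g₀ os cΛ M Φ b₀ p₁ η η' κ κ₂ κᵥ P X 𝒢 μ) :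
    ∀ K t, |t| ≤ Sd.l₀ → Sd.K₀ ≤ K →
      ∀ k ∈ badGMems (memA n F.L (Sd.𝒮.reading Sd.T Sd.p₀)) jhalf (HIndex.termSet (skelFam Sd.T Sd.p₀))
          (kmemA n F.L hn (lt_of_lt_of_le (by norm_num) (two_le_L F)) (Sd.𝒮.reading Sd.T Sd.p₀)) K,
        ∑ τ ∈ fibre (kmemA n F.L hn (lt_of_lt_of_le (by norm_num) (two_le_L F)) (Sd.𝒮.reading Sd.T Sd.p₀))
            (HIndex.termSet (skelFam Sd.T Sd.p₀)) K k, weightB μ (reprFam Sd.T Sd.p₀ Sd.ρ₀ Sd.hρ₀ Sd.h0 (fun _ _ => 1) (fun _ _ => one_pos)) Sd.trunc K t τ ≤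
          Sd.qB K k * ∑ σ ∈ HIndex.termSet (skelFam Sd.T Sd.p₀) K, weightB μ (reprFam Sd.T Sd.p₀ Sd.ρ₀ Sd.hρ₀ Sd.h0 (fun _ _ => 1) (fun _ _ => one_pos)) Sd.trunc K t σ := by
  intro K t ht hK k hk
  rw [weightB, sum_fibre_aggW_eq,
    sum_aggW_eq (S := fun K => HIndex.termSet (skelFam Sd.T Sd.p₀) (K + 1))
      (w := fun _ t τ' => Repr172R.weight μ (reprFam Sd.T Sd.p₀ Sd.ρ₀ Sd.hρ₀ Sd.h0 (fun _ _ => 1) (fun _ _ => one_pos)) t τ') (Sd.htr K hK)]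
  exact Sd.extractB K t ht hK k hk

/-- **E1: run A's terms sum to the dressed integral** — `Sd.H2A` and M2-A's `Repr172R.integral_eq_sum_weight` at `holdsFam` ∕ `Sd.intA`
(IR-103-1 part 2's `reprA`, verbatim). [folklore] -/
theorem reprA_of_towerExtractionPriced (Sd : TowerExtractionPricedDataLWR D C O θv rr d n hn g₀ os cΛ M Φ b₀ p₁ η η' κ κ₂ κᵥ P X 𝒢 μ) :
    ∀ K t, |t| ≤ Sd.l₀ → Sd.K₀ ≤ K →
      ∫ U, Real.exp (t * T4GenFunBounds.prodObs (D.scheme g₀) K os U) * D.dens K (g₀ K) 0 U ∂fieldMeasure (F.P K) 0 G =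
        ∑ τ ∈ HIndex.termSet (skelFam Sd.T Sd.p₀) K, Repr172R.weight μ (reprFam Sd.T Sd.p₀ Sd.ρ₀ Sd.hρ₀ Sd.h0 (fun _ _ => 1) (fun _ _ => one_pos)) t τ :=
  fun K t ht hK => (Sd.H2A K t ht hK).trans
    (Repr172R.integral_eq_sum_weight μ (reprFam Sd.T Sd.p₀ Sd.ρ₀ Sd.hρ₀ Sd.h0 (fun _ _ => 1) (fun _ _ => one_pos)) K t (densFam Sd.T Sd.ρ₀ K t)
      (holdsFam Sd.T Sd.p₀ Sd.ρ₀ Sd.hρ₀ Sd.h0 (fun _ _ => 1) (fun _ _ => one_pos) Sd.hp₀ K t) (Sd.intA K t))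

/-- **E2: run B's terms (the family at cutoff `K + 1`, through `trunc`) sum to the dressed integral after `K + 1` steps** — `Sd.H2A (K + 1)`
and `B16HistoryIndexedTrunc.reprB_of_holds_trunc` with `Sd.htr` (IR-103-1 part 2's `reprB`, verbatim). [folklore] -/
theorem reprB_of_towerExtractionPriced (Sd : TowerExtractionPricedDataLWR D C O θv rr d n hn g₀ os cΛ M Φ b₀ p₁ η η' κ κ₂ κᵥ P X 𝒢 μ) :
    ∀ K t, |t| ≤ Sd.l₀ → Sd.K₀ ≤ K →
      ∫ U, Real.exp (t * T4GenFunBounds.prodObs (D.scheme g₀) (K + 1) os U) * D.dens (K + 1) (g₀ (K + 1)) 0 U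
          ∂fieldMeasure (F.P (K + 1)) 0 G =
        ∑ τ ∈ HIndex.termSet (skelFam Sd.T Sd.p₀) K, weightB μ (reprFam Sd.T Sd.p₀ Sd.ρ₀ Sd.hρ₀ Sd.h0 (fun _ _ => 1) (fun _ _ => one_pos)) Sd.trunc K t τ :=
  fun K t ht hK => (Sd.H2A (K + 1) t ht (Nat.le_succ_of_le hK)).trans
    (reprB_of_holds_trunc μ (reprFam Sd.T Sd.p₀ Sd.ρ₀ Sd.hρ₀ Sd.h0 (fun _ _ => 1) (fun _ _ => one_pos)) Sd.trunc K (fun t => ∫ x, densFam Sd.T Sd.ρ₀ (K + 1) t x ∂μ (K + 1))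
      (densFam Sd.T Sd.ρ₀ (K + 1)) (fun _ => rfl)
      (holdsFam Sd.T Sd.p₀ Sd.ρ₀ Sd.hρ₀ Sd.h0 (fun _ _ => 1) (fun _ _ => one_pos) Sd.hp₀ (K + 1)) (Sd.intA (K + 1))
      (Sd.htr K hK) t)

/-- **THE READING IS WEAKLY REALISED BY THE RUN's OWN PROFILE WITH ITS DOMAINS** (the `_rel` END's `H` at the tower): JunctionV's
`InputFamily.realisedDomainsRW_of_familyV` on the tower reading `Sd.𝒮.reading Sd.T Sd.p₀`, the per-term inputs read off the record exactly
as 2R's `toLP82R` reads them (`hN := 𝒮.newOK_run … hν`, `hRm ∕ hRmS ∕ hRm2`, `hD`), the box input from `hreg`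
(`RunInputM.inBoxOK_of_regionsInBox`, L5's plug 1), transported along (c1)'s equations `Sd.hL ∕ Sd.hs`. [folklore] -/
theorem realised_of_towerExtractionPriced (Sd : TowerExtractionPricedDataLWR D C O θv rr d n hn g₀ os cΛ M Φ b₀ p₁ η η' κ κ₂ κᵥ P X 𝒢 μ) :
    RealisedDomainsRW F.L (runProfile F.L (Sd.𝒮.reading Sd.T Sd.p₀).R) n Sd.K₀ (Sd.𝒮.reading Sd.T Sd.p₀).R (HIndex.termSet (skelFam Sd.T Sd.p₀))
      (Sd.𝒮.reading Sd.T Sd.p₀).inputOf.pedV (fun _ _ => id) (Sd.𝒮.reading Sd.T Sd.p₀).inputOf.liveCV (Sd.𝒮.reading Sd.T Sd.p₀).inputOf.ZV := by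
  have hL0 : 0 < (Sd.𝒮.reading Sd.T Sd.p₀).L := by
    rw [show (Sd.𝒮.reading Sd.T Sd.p₀).L = F.L from Sd.hL]; exact lt_of_lt_of_le (by norm_num) (two_le_L F)
  have hN : ∀ K, Sd.K₀ ≤ K → ∀ τ ∈ HIndex.termSet (skelFam Sd.T Sd.p₀) K, ((Sd.𝒮.reading Sd.T Sd.p₀).inputOf.run K τ).NewOK :=
    fun K _ τ _ => Sd.𝒮.newOK_run Sd.T Sd.p₀ Sd.hν K τ
  have h0 : RealisedDomainsRW (Sd.𝒮.reading Sd.T Sd.p₀).L (Sd.𝒮.reading Sd.T Sd.p₀).s n Sd.K₀ (Sd.𝒮.reading Sd.T Sd.p₀).R (HIndex.termSet (skelFam Sd.T Sd.p₀))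
      (Sd.𝒮.reading Sd.T Sd.p₀).inputOf.pedV (fun _ _ => id) (Sd.𝒮.reading Sd.T Sd.p₀).inputOf.liveCV (Sd.𝒮.reading Sd.T Sd.p₀).inputOf.ZV :=
    (Sd.𝒮.reading Sd.T Sd.p₀).inputOf.realisedDomainsRW_of_familyV (HIndex.termSet (skelFam Sd.T Sd.p₀)) n Sd.K₀ hN
      (fun K _ _ _ t k => Sd.hRm K t k) (fun K hK _ _ t k => Sd.hRmS K hK t k) (fun K hK _ _ t => Sd.hRm2 K hK t) Sd.hD hL0
      (fun K hK τ hτ => RunInputM.inBoxOK_of_regionsInBox (hN K hK τ hτ) (Sd.hreg K hK τ hτ))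
  rw [show (Sd.𝒮.reading Sd.T Sd.p₀).L = F.L from Sd.hL, show (Sd.𝒮.reading Sd.T Sd.p₀).s = runProfile F.L (Sd.𝒮.reading Sd.T Sd.p₀).R from Sd.hs] at h0
  exact h0

/-- **CONSTITUENTS BOXED AT THEIR BIRTH LEVELS** (the `_rel` END's `hBB` at the tower): `InputFamily.boxedBirths_pedV … hreg` (L5's plug 3),
transported along `Sd.hL ∕ Sd.hs`. [folklore] -/
theorem boxedBirths_of_towerExtractionPriced (Sd : TowerExtractionPricedDataLWR D C O θv rr d n hn g₀ os cΛ M Φ b₀ p₁ η η' κ κ₂ κᵥ P X 𝒢 μ) :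
    ∀ K, Sd.K₀ ≤ K → ∀ τ ∈ HIndex.termSet (skelFam Sd.T Sd.p₀) K, ∀ c ∈ (Sd.𝒮.reading Sd.T Sd.p₀).inputOf.liveCV K τ,
      BoxedBirths n F.L K (levelOf (runProfile F.L (Sd.𝒮.reading Sd.T Sd.p₀).R K) K) (((Sd.𝒮.reading Sd.T Sd.p₀).inputOf.pedV K τ).toPGen id c) := by
  have hL0 : 0 < (Sd.𝒮.reading Sd.T Sd.p₀).L := by
    rw [show (Sd.𝒮.reading Sd.T Sd.p₀).L = F.L from Sd.hL]; exact lt_of_lt_of_le (by norm_num) (two_le_L F)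
  have h0 : ∀ K, Sd.K₀ ≤ K → ∀ τ ∈ HIndex.termSet (skelFam Sd.T Sd.p₀) K, ∀ c ∈ (Sd.𝒮.reading Sd.T Sd.p₀).inputOf.liveCV K τ,
      BoxedBirths n (Sd.𝒮.reading Sd.T Sd.p₀).L K (levelOf ((Sd.𝒮.reading Sd.T Sd.p₀).s K) K) (((Sd.𝒮.reading Sd.T Sd.p₀).inputOf.pedV K τ).toPGen id c) :=
    (Sd.𝒮.reading Sd.T Sd.p₀).inputOf.boxedBirths_pedV (HIndex.termSet (skelFam Sd.T Sd.p₀)) n Sd.K₀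
      (fun K _ τ _ => Sd.𝒮.newOK_run Sd.T Sd.p₀ Sd.hν K τ)
      (fun K _ _ _ t k => Sd.hRm K t k) (fun K hK _ _ t k => Sd.hRmS K hK t k) (fun K hK _ _ t => Sd.hRm2 K hK t) Sd.hD hL0
      Sd.hreg
  rw [show (Sd.𝒮.reading Sd.T Sd.p₀).L = F.L from Sd.hL, show (Sd.𝒮.reading Sd.T Sd.p₀).s = runProfile F.L (Sd.𝒮.reading Sd.T Sd.p₀).R from Sd.hs] at h0
  exact h0

/-- **THE GUARDED JOIN DISPLAY, PROVED ON PASS V** (the `_rel` END's `hDJ` at the tower): `InputFamily.disjointJoinsL_pedV` (L5's plug 2).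
[folklore] -/
theorem disjointJoinsL_of_towerExtractionPriced (Sd : TowerExtractionPricedDataLWR D C O θv rr d n hn g₀ os cΛ M Φ b₀ p₁ η η' κ κ₂ κᵥ P X 𝒢 μ) :
    ∀ K, Sd.K₀ ≤ K → ∀ τ ∈ HIndex.termSet (skelFam Sd.T Sd.p₀) K, ∀ c ∈ (Sd.𝒮.reading Sd.T Sd.p₀).inputOf.liveCV K τ,
      DisjointJoinsL (((Sd.𝒮.reading Sd.T Sd.p₀).inputOf.pedV K τ).toPGen id c) :=
  have hL0 : 0 < (Sd.𝒮.reading Sd.T Sd.p₀).L := by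
    rw [show (Sd.𝒮.reading Sd.T Sd.p₀).L = F.L from Sd.hL]; exact lt_of_lt_of_le (by norm_num) (two_le_L F)
  (Sd.𝒮.reading Sd.T Sd.p₀).inputOf.disjointJoinsL_pedV (HIndex.termSet (skelFam Sd.T Sd.p₀)) Sd.K₀
    (fun K _ τ _ => Sd.𝒮.newOK_run Sd.T Sd.p₀ Sd.hν K τ)
    (fun K _ _ _ t k => Sd.hRm K t k) (fun K hK _ _ t k => Sd.hRmS K hK t k) (fun K hK _ _ t => Sd.hRm2 K hK t) Sd.hD hL0

end Road

/-! ## §2 Under the prefix: the apex input from the record family, for all small couplings -/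

section Under

variable {F : T4Family} {G : Type*} [GaugeGroup G] [MeasurableSpace G] [HaarData G]

/-- **ROW NE7b, (α) ROAD AT THE TOWER, COUNT DERIVED, AT THE APEX: `HybridNE7Under D (BetaPertHyp D.βfun)`** from «for all SMALL-coupling
tuned runs and every loop string, a `TowerExtractionPricedDataLWR` record» and the END's constants-side binders (2R's list minus `hsign`,
unsplit slack).  Proof (L3b's `hybridNE7Under_of_countRoadT3bPWTVSL_fsc` pattern): `intro _ hβ`; the pinned `_rel` END's thresholds at `hβ` `min`-ed with the
record family's; for a tuned run in the window and a string, the record `Sd` feeds the pinned `_rel` END — `R := (Sd.𝒮.reading Sd.T Sd.p₀).R`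
(`Sd.isRj`, `Sd.one_le_R`), the pass-V carriers `pedV ∕ id ∕ liveCV ∕ ZV` with §1's `realised_…`, `step_le` by `le_rfl` on the image,
`disjointJoinsL_…`, `boxedBirths_…`; `κ = κ′ := costT`, `hκ = hκ′ := le_rfl`; `hA0 ∕ hA0′ := Repr172R.weight_nonneg ∕ weightB_nonneg` at the
letter `1`; `hqA hqB fibM fibM′ hPq hPq′ := Sd.qA_nonneg Sd.qB_nonneg Sd.extractA (fibM'_of_extractB Sd) Sd.priceA Sd.priceB`; `hSh hTB :=
Sd.shell Sd.budget`; the four rates —, then `HistoryRealiseCellsRunApexT3b.stringHybridNE7_of_hybridNE7_repr` with §1's E1∕E2.  The pin `(B)`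
is NOT read on this road; `hβ` IS (the END's flow rows) — hence `Hβ := BetaPertHyp D.βfun` and no `EndpointExistence` twin.  Honest reading:
the apex input ⇐ [BetaPertHyp ∧ ∀ small-coupling tuned run ∀ string: the extraction displays + the price sentences + NE7c + NE7 + rates +
the reading's clauses, DISPLAYED].  CONDITIONAL; NE7b NOT proved. [folklore] -/
theorem hybridNE7Under_of_towerExtractionPriced_fsc (D : FiniteEpsData F G)
    {C : T4PrintedShapeBanking.Consts} {O : PrintedO1s}
    {rr : ℕ} {β₀ : ℝ} (h : ThresholdOK C F.L rr β₀) (hμ : 0 < C.μ) (d n : ℕ)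
    (hκ₁ : (d : ℝ) * Real.log F.L + 2 * Real.log 2 ≤ C.κ₁) (hE₀ : Real.log (2 + birthMass C) ≤ C.E₀)
    (hA₀ : 1 ≤ C.A₀) (hβ₀ : 0 < β₀) (hLβ : (F.L : ℝ) * β₀ ≤ 1) (hn₁ : 13 ≤ C.n₁) (hn : 0 < n)
    {θ : ℝ} (hθ : 0 < θ) (hslack : C.a + θ ≤ O.γ₀ * O.A₁ ^ 2 / 2)
    (hE₂ : 0 < C.E₂) (hE₃ : 0 ≤ C.E₃) {sS : ℕ} (hsS : 1 ≤ sS)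
    (hsmall : (((2 * cth 32 1 sS + 1) ^ d : ℕ) : ℝ) * (5 : ℝ) ^ d * ((max 1 (2 * 32 + 2) : ℕ) : ℝ) ≤
      (F.L : ℝ) ^ (sS / 2) / 2)
    {θc : ℝ} (hθc0 : 0 ≤ θc) (hθc1 : θc < 1) (hθcs : 1 / 2 ≤ θc ^ sS)
    {θv cΛ M Φ b₀ : ℝ} {p₁ η η' κ κ₂ κᵥ : ℕ}
    (hRead : T4ContinuumYM4Torus.ForSmallCouplings D fun g₀ => ∀ os : List (ULoop F),
      ∃ (P : Type) (_ : DecidableEq P) (X : ℕ → ℕ → Type) (𝒢 : (K j : ℕ) → GoodClass (X K j))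
        (_ : ∀ K, MeasurableSpace (X K K)) (μ : (K : ℕ) → Measure (X K K)) (_ : ∀ K, IsFiniteMeasure (μ K)),
        Nonempty (TowerExtractionPricedDataLWR D C O θv rr d n hn g₀ os cΛ M Φ b₀ p₁ η η' κ κ₂ κᵥ P X 𝒢 μ)) :
    T4ApexHybrid.HybridNE7Under D (BetaPertHyp D.βfun) := by
  intro _ hβ
  obtain ⟨γ₁, hγ₁, H⟩ := hybridNE7_of_realisedDomainsRunW_pinnedT3bPDTL_rel D hβ h hμ d n hκ₁ hE₀ hA₀ hβ₀ hLβ hn₁ hn hθ hslack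
    hE₂ hE₃ hsS hsmall hθc0 hθc1 hθcs
  obtain ⟨γ₂, hγ₂, H₂⟩ := hRead
  refine ⟨min γ₁ γ₂, lt_min hγ₁ hγ₂, fun γ hγ hγle => ?_⟩
  obtain ⟨g₁, hg₁, Hg⟩ := H γ hγ (hγle.trans (min_le_left _ _))
  obtain ⟨g₂, hg₂, Hg₂⟩ := H₂ γ hγ (hγle.trans (min_le_right _ _))
  refine ⟨min g₁ g₂, lt_min hg₁ hg₂, fun g hg hgle g₀ ht os => ?_⟩
  obtain ⟨P, _, X, 𝒢, _, μ, _, ⟨Sd⟩⟩ := Hg₂ g hg (hgle.trans (min_le_right _ _)) g₀ ht os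
  obtain ⟨K₁, K₂, hK₁, hH⟩ := Hg g hg (hgle.trans (min_le_left _ _)) g₀ ht Sd.l₀ Sd.vol Sd.K₀
    (HIndex.termSet (skelFam Sd.T Sd.p₀)) (fun _ t => Repr172R.weight μ (reprFam Sd.T Sd.p₀ Sd.ρ₀ Sd.hρ₀ Sd.h0 (fun _ _ => 1) (fun _ _ => one_pos)) t)
    (weightB μ (reprFam Sd.T Sd.p₀ Sd.ρ₀ Sd.hρ₀ Sd.h0 (fun _ _ => 1) (fun _ _ => one_pos)) Sd.trunc) Sd.shA Sd.shB
    Sd.Cc Sd.Rr Sd.CcRec Sd.RrRec Sd.ν Sd.u Sd.s₂ Sd.q₀ Sd.r Sd.s Sd.Wsh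
    -- the (2.5) size function = the reading's sizes
    (Sd.𝒮.reading Sd.T Sd.p₀).R Sd.isRj Sd.one_le_R
    -- the READING: pass V's carriers, weakly realised with their domains; its clauses
    (Sd.𝒮.reading Sd.T Sd.p₀).inputOf.pedV (fun _ _ => id) (Sd.𝒮.reading Sd.T Sd.p₀).inputOf.liveCV (Sd.𝒮.reading Sd.T Sd.p₀).inputOf.ZV
    (realised_of_towerExtractionPriced Sd)
    (fun K _ τ _ c hc => by
      obtain ⟨x, -, rfl⟩ := Finset.mem_image.1 hc
      exact le_rfl)
    (disjointJoinsL_of_towerExtractionPriced Sd) (boxedBirths_of_towerExtractionPriced Sd)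
    -- the realised costs AT the model's total cost (`κ = κ′ := costT`, `le_rfl`)
    (fun K _ => costT Prod.fst C K ((Sd.𝒮.reading Sd.T Sd.p₀).R K)) (fun K _ => costT Prod.fst C K ((Sd.𝒮.reading Sd.T Sd.p₀).R K))
    (fun _ _ _ _ _ _ => le_rfl) (fun _ _ _ _ _ _ => le_rfl)
    -- the RE-CUT numerator side, FROM THE RECORD
    (fun K t _ _ τ _ => Repr172R.weight_nonneg μ _ t (fun _ _ _ => zero_le_one) τ)
    (fun K t _ _ τ _ => weightB_nonneg μ _ Sd.trunc K t (fun _ _ _ => zero_le_one) τ)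
    Sd.qA Sd.qB Sd.qA_nonneg Sd.qB_nonneg Sd.extractA (fibM'_of_extractB Sd) Sd.priceA Sd.priceB
    -- the seam's other inputs
    Sd.shell Sd.budget Sd.sum_r Sd.sum_u Sd.sum_s Sd.sum_s₂
  exact ⟨Sd.l₀, Sd.vol, K₁ + K₂, Sd.l₀_pos, Sd.vol_pos,
    stringHybridNE7_of_hybridNE7_repr D (reprA_of_towerExtractionPriced Sd) (reprB_of_towerExtractionPriced Sd) hK₁ hH⟩

end Under

/-! ## §3 The four targets and the headline for printed data on `SU(N)` -/

section SU

variable {F : T4Family} {N : ℕ} [NeZero N] {ℰ : LoopAverage (Matrix.specialUnitaryGroup (Fin N) ℂ)}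

/-- **THE FOUR T⁴ TARGETS FROM A TOWER FAMILY CARRYING THE EXTRACTION DISPLAYS AND THE PRICE SENTENCES**, for (0.4)-block-averaged data
on `SU(N)` with a measurable small-loop average — §2 ∘ `T4ApexHybrid.targets_of_hybridNE7Under`.  CONDITIONAL on (B), `BetaPertHyp` (inside
the targets' own prefix) and everything the record displays; NE7b NOT proved. [folklore] -/
theorem targets_of_towerExtractionPriced_fsc (D : FiniteEpsData F (Matrix.specialUnitaryGroup (Fin N) ℂ))
    (hBA : D.IsBlockAveraged ℰ) (hE : ℰ.MeasurableE)
    {C : T4PrintedShapeBanking.Consts} {O : PrintedO1s}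
    {rr : ℕ} {β₀ : ℝ} (h : ThresholdOK C F.L rr β₀) (hμ : 0 < C.μ) (d n : ℕ)
    (hκ₁ : (d : ℝ) * Real.log F.L + 2 * Real.log 2 ≤ C.κ₁) (hE₀ : Real.log (2 + birthMass C) ≤ C.E₀)
    (hA₀ : 1 ≤ C.A₀) (hβ₀ : 0 < β₀) (hLβ : (F.L : ℝ) * β₀ ≤ 1) (hn₁ : 13 ≤ C.n₁) (hn : 0 < n)
    {θ : ℝ} (hθ : 0 < θ) (hslack : C.a + θ ≤ O.γ₀ * O.A₁ ^ 2 / 2)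
    (hE₂ : 0 < C.E₂) (hE₃ : 0 ≤ C.E₃) {sS : ℕ} (hsS : 1 ≤ sS)
    (hsmall : (((2 * cth 32 1 sS + 1) ^ d : ℕ) : ℝ) * (5 : ℝ) ^ d * ((max 1 (2 * 32 + 2) : ℕ) : ℝ) ≤
      (F.L : ℝ) ^ (sS / 2) / 2)
    {θc : ℝ} (hθc0 : 0 ≤ θc) (hθc1 : θc < 1) (hθcs : 1 / 2 ≤ θc ^ sS)
    {θv cΛ M Φ b₀ : ℝ} {p₁ η η' κ κ₂ κᵥ : ℕ}
    (hRead : T4ContinuumYM4Torus.ForSmallCouplings D fun g₀ => ∀ os : List (ULoop F),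
      ∃ (P : Type) (_ : DecidableEq P) (X : ℕ → ℕ → Type) (𝒢 : (K j : ℕ) → GoodClass (X K j))
        (_ : ∀ K, MeasurableSpace (X K K)) (μ : (K : ℕ) → Measure (X K K)) (_ : ∀ K, IsFiniteMeasure (μ K)),
        Nonempty (TowerExtractionPricedDataLWR D C O θv rr d n hn g₀ os cΛ M Φ b₀ p₁ η η' κ κ₂ κᵥ P X 𝒢 μ)) :
    D.ym4_torus_continuum_limit_exists ∧ D.ym4_torus_continuum_limit_unique ∧
      D.limit_reflectionPositive ∧ D.limit_torusCovariant :=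
  T4ApexHybrid.targets_of_hybridNE7Under hBA hE
    (hybridNE7Under_of_towerExtractionPriced_fsc D h hμ d n hκ₁ hE₀ hA₀ hβ₀ hLβ hn₁ hn hθ hslack hE₂ hE₃ hsS hsmall hθc0 hθc1
      hθcs hRead)

/-- **THE HEADLINE PREDICATE FROM A TOWER FAMILY CARRYING THE TWO EXTRACTION DISPLAYS AND THE TWO PRICE SENTENCES — COUNT DERIVED**:
`ContinuumYM4Torus D` for (0.4)-block-averaged data on `SU(N)` with a measurable small-loop average, GIVEN the pins `(B) =
B16.EndStatementBPrinted D.C` (consumed ONLY by `T4ContinuumYM4Torus.continuumYM4Torus_of_targets`) and `BetaPertHyp D.βfun` (consumed there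
AND by the pinned `_rel` END's flow side) BY NAME, the END's constants-side binders — `ThresholdOK`, `0 < C.μ`, the κ₁∕E₀ largeness, `1 ≤ A₀`, `0 < β₀`, `L·β₀ ≤ 1`,
`13 ≤ n₁`, `0 < n`, `0 < θ` with the UNSPLIT slack `C.a + θ ≤ ½γ₀A₁²`, `0 < E₂`, `0 ≤ E₃`, row S6g′'s `sS ∕ θc` arithmetic (2R's
`B16HistoryTowerEndLWRP82.continuumYM4Torus_of_towerReadingLWR_fsc` list minus `hsign`; inhabited by O(1) constants, not re-proved here) —,
the eleven window letters `θᵥ cΛ M Φ b₀ p₁ η η′ κ κ₂ κᵥ` (bound here; displayed rows only), and — for all small-coupling tuned runs and every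
loop string — SOME record `TowerExtractionPricedDataLWR … P X 𝒢 μ` (four carriers).  Proof: §3's targets ∘ `continuumYM4Torus_of_targets`.
CONDITIONAL on everything the record displays (`extractA ∕ extractB`, `priceA ∕ priceB`, the reading's clauses, NE7c, NE7, rates, flow,
print's sentences); NE7b NOT proved; count 0∕9. [folklore] -/
theorem continuumYM4Torus_of_towerExtractionPriced_fsc (D : FiniteEpsData F (Matrix.specialUnitaryGroup (Fin N) ℂ))
    (hBA : D.IsBlockAveraged ℰ) (hE : ℰ.MeasurableE) (hB : B16.EndStatementBPrinted D.C) (hβ : BetaPertHyp D.βfun)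
    {C : T4PrintedShapeBanking.Consts} {O : PrintedO1s}
    {rr : ℕ} {β₀ : ℝ} (h : ThresholdOK C F.L rr β₀) (hμ : 0 < C.μ) (d n : ℕ)
    (hκ₁ : (d : ℝ) * Real.log F.L + 2 * Real.log 2 ≤ C.κ₁) (hE₀ : Real.log (2 + birthMass C) ≤ C.E₀)
    (hA₀ : 1 ≤ C.A₀) (hβ₀ : 0 < β₀) (hLβ : (F.L : ℝ) * β₀ ≤ 1) (hn₁ : 13 ≤ C.n₁) (hn : 0 < n)
    {θ : ℝ} (hθ : 0 < θ) (hslack : C.a + θ ≤ O.γ₀ * O.A₁ ^ 2 / 2)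
    (hE₂ : 0 < C.E₂) (hE₃ : 0 ≤ C.E₃) {sS : ℕ} (hsS : 1 ≤ sS)
    (hsmall : (((2 * cth 32 1 sS + 1) ^ d : ℕ) : ℝ) * (5 : ℝ) ^ d * ((max 1 (2 * 32 + 2) : ℕ) : ℝ) ≤
      (F.L : ℝ) ^ (sS / 2) / 2)
    {θc : ℝ} (hθc0 : 0 ≤ θc) (hθc1 : θc < 1) (hθcs : 1 / 2 ≤ θc ^ sS)
    {θv cΛ M Φ b₀ : ℝ} {p₁ η η' κ κ₂ κᵥ : ℕ}
    (hRead : T4ContinuumYM4Torus.ForSmallCouplings D fun g₀ => ∀ os : List (ULoop F),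
      ∃ (P : Type) (_ : DecidableEq P) (X : ℕ → ℕ → Type) (𝒢 : (K j : ℕ) → GoodClass (X K j))
        (_ : ∀ K, MeasurableSpace (X K K)) (μ : (K : ℕ) → Measure (X K K)) (_ : ∀ K, IsFiniteMeasure (μ K)),
        Nonempty (TowerExtractionPricedDataLWR D C O θv rr d n hn g₀ os cΛ M Φ b₀ p₁ η η' κ κ₂ κᵥ P X 𝒢 μ)) :
    T4ContinuumYM4Torus.ContinuumYM4Torus D :=
  T4ContinuumYM4Torus.continuumYM4Torus_of_targets hB hβ
    (targets_of_towerExtractionPriced_fsc D hBA hE h hμ d n hκ₁ hE₀ hA₀ hβ₀ hLβ hn₁ hn hθ hslack hE₂ hE₃ hsS hsmall hθc0 hθc1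
      hθcs hRead)

end SU

end

end Summit.QuantumFields.BalabanUV.T4Continuum.B16HistoryTowerExtractionEnd2
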